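import Summits.MatrixMultiplication.OmegaCensus.DicyclicLawQuotientCyclic
import Summits.MatrixMultiplication.OmegaCensus.DicyclicLawReduction
import Summits.MatrixMultiplication.OmegaCensus.DihedralLikeLaw
import HarnessLib

/-!
# Restriction to an index-two subgroup: two "small" members kill the dicyclic law when `A/⟨c₀⟩ ↠ 𝔽₂³`

ω-census `pub-omega`, family (b3), seat pub-omega-group gen 13.  Framing: lottery ticket; floor = certified bounds/negative
ranges.  VALUE: a kernel tool for the TPP capacity of dihedral-like groups (sub-family (b3) of the group-theoretic
method); NOT progress on ω.

Dicyclic type `G = G(A, c₀)` (`ρ, τ : A → G` with the dihedral-like relations, `c₀ ≠ 0`), `|A| ≡ 2 (mod 3)`, `|A| ≥ 28`,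
and three homomorphisms `A →+ ZMod 2` killing `c₀`, jointly onto `𝔽₂³` (i.e. `A/⟨c₀⟩` has `2`-rank `≥ 3`; NO `2`-group
hypothesis on `A/⟨c₀⟩`).  For a non-zero homomorphism `φ : A →+ ZMod 2` with `φ c₀ = 0` the set
`H = ρ(ker φ) ∪ τ(x + ker φ)` is a subgroup of `G` of index `2`, again of dicyclic type, over `A' = ker φ ∋ c₀`
(`|A'| = |A|/2 ≡ 1 (mod 3)`).  A member `X` of a TPP triple lies in ONE right coset of `H` iff `φ` is constant on each
coset part `X₀ = {a : ρ a ∈ X}`, `X₁ = {a : τ a ∈ X}` with `φ(X₁) = φ(X₀) + φ x`.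

**Theorem (`no_dicyclic_law_of_two_small`).** If a TPP triple `(S, T, U)` attains the dicyclic law
`3|S||T||U| + 16 = 8|A|` then `S` and `U` cannot both lie in right cosets of a common such `H`; i.e. there are no `φ ≠ 0`
(`φ c₀ = 0`), `x ∈ A`, `e, f ∈ 𝔽₂` with `φ ≡ e` on `S₀`, `φ ≡ e + φ x` on `S₁`, `φ ≡ f` on `U₀`, `φ ≡ f + φ x` on `U₁`.
(`_first_second`, `_second_third`: the same for the pairs `(S, T)` and `(T, U)`.)

*Proof.* Right-translate `S` and `U` into `H` and keep the larger half `T'` of `T` (`2|T'| ≥ |T|`), translated into `H`;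
right translation preserves the TPP (`TripleProductProperty.map_mulRight`) and so does passing to the subgroup
(`tpp_subtype`).  In `H ≅ G(A', c₀)` the volume `|S||T'||U| ≥ |S||T||U|/2 = (8|A'| − 8)/3` reaches the mod-one law bound
`tpp_volume_le_law_dihedralLike_mod_one`, so the mod-one law of the dicyclic-type group `H` is attained and
`quot_cyclic_of_mod_one_law_of_c0_ne_zero` (gen 8) makes `A'/⟨c₀⟩` cyclic: `A' = ⟨g⟩ ∪ (c₀ + ⟨g⟩)`.  Then `A` is the union
of the four cosets `{0, c₀, a₁, a₁ + c₀} + ⟨g⟩` (`φ a₁ = 1`) and `psi_not_onto_of_four_cosets` contradicts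
`A/⟨c₀⟩ ↠ 𝔽₂³`.  ∎

Use: class P1 below; classes N2/N3 for ALL quotients of `2`-rank `≥ 3` (gen 13, `FAMILY-B-ADDENDUM-g13.md`).
-/

namespace Summit.MatrixMultiplication.OmegaCensus

open Literature.Combinatorics.Additive Finset

/-! ## TPP triples inside a subgroup -/

section Subtype

variable {G : Type} [Group G]

/-- The triple product property passes to a subgroup: the parts of `S, T, U` inside `H`, viewed in the group `H`, again
satisfy the TPP (the defining condition is the same equation read in `G`). [folklore] -/
theorem tpp_subtype (H : Subgroup G) [DecidablePred (· ∈ H)] {S T U : Finset G} (h : TripleProductProperty S T U) :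
    TripleProductProperty (S.subtype (· ∈ H)) (T.subtype (· ∈ H)) (U.subtype (· ∈ H)) := by
  intro s hs s' hs' t ht t' ht' u hu u' hu' he
  rw [Finset.mem_subtype] at hs hs' ht ht' hu hu'
  have he' : (s : G) * (s' : G)⁻¹ * ((t : G) * (t' : G)⁻¹) * ((u : G) * (u' : G)⁻¹) = 1 := by
    have := congrArg Subtype.val he
    simpa only [Subgroup.coe_mul, Subgroup.coe_inv, Subgroup.coe_one] using this
  obtain ⟨h1, h2, h3⟩ := h _ hs _ hs' _ ht _ ht' _ hu _ hu' he'
  exact ⟨Subtype.ext h1, Subtype.ext h2, Subtype.ext h3⟩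

/-- A finset contained in the subgroup `H` keeps its cardinality when viewed inside `H`. [folklore] -/
theorem card_subtype_of_subset (H : Subgroup G) [DecidablePred (· ∈ H)] {S : Finset G} (hS : ∀ g ∈ S, g ∈ H) :
    (S.subtype (· ∈ H)).card = S.card := by
  rw [Finset.card_subtype, Finset.filter_true_of_mem hS]

/-- Membership in a right translate: `g ∈ S·c ↔ g c⁻¹ ∈ S`. [folklore] -/
theorem mem_map_mulRight_iff {S : Finset G} {c g : G} :
    g ∈ S.map (Equiv.mulRight c).toEmbedding ↔ g * c⁻¹ ∈ S := by
  rw [Finset.mem_map_equiv, Equiv.mulRight_symm_apply]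

end Subtype

/-! ## The restriction theorem -/

section Restriction

variable {A : Type} [AddCommGroup A] [DecidableEq A] [Fintype A] {G : Type} [Group G] [DecidableEq G]
  {ρ τ : A → G} {c₀ : A}

omit [DecidableEq A] [Fintype A] [DecidableEq G] in
/-- The index-two subgroup `H = ρ(ker φ) ∪ τ(x + ker φ)` of a dicyclic-type group: closure properties of the carrier
`{g | ∃ a, φ a = 0 ∧ (g = ρ a ∨ g = τ(x + a))}` (`φ c₀ = 0`). [folklore] -/
theorem exists_subgroup_of_hom
    (hρρ : ∀ a b, ρ a * ρ b = ρ (a + b)) (hρτ : ∀ a b, ρ a * τ b = τ (b - a))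
    (hτρ : ∀ a b, τ a * ρ b = τ (a + b)) (hττ : ∀ a b, τ a * τ b = ρ (c₀ + b - a))
    (φ : A →+ ZMod 2) (hφc : φ c₀ = 0) (x : A) :
    ∃ H : Subgroup G, ∀ g : G, g ∈ H ↔ ∃ a : A, φ a = 0 ∧ (g = ρ a ∨ g = τ (x + a)) := by
  refine ⟨{ carrier := setOf fun g => ∃ a : A, φ a = 0 ∧ (g = ρ a ∨ g = τ (x + a))
            mul_mem' := ?_
            one_mem' := ?_
            inv_mem' := ?_ }, fun g => Iff.rfl⟩
  · rintro g g' ⟨a, ha, hg⟩ ⟨b, hb, hg'⟩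
    rcases hg with rfl | rfl <;> rcases hg' with rfl | rfl
    · exact ⟨a + b, by rw [map_add, ha, hb, add_zero], Or.inl (hρρ a b)⟩
    · refine ⟨b - a, by rw [map_sub, ha, hb, sub_zero], Or.inr ?_⟩
      rw [hρτ]; congr 1; abel
    · refine ⟨a + b, by rw [map_add, ha, hb, add_zero], Or.inr ?_⟩
      rw [hτρ]; congr 1; abel
    · refine ⟨c₀ + b - a, by rw [map_sub, map_add, hφc, ha, hb, add_zero, sub_zero], Or.inl ?_⟩
      rw [hττ]; congr 1; abel
  · exact ⟨0, map_zero φ, Or.inl (rho_zero hρρ).symm⟩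
  · rintro g ⟨a, ha, hg⟩
    rcases hg with rfl | rfl
    · exact ⟨-a, by rw [map_neg, ha, neg_zero], Or.inl (inv_rho hρρ a)⟩
    · refine ⟨a - c₀, by rw [map_sub, ha, hφc, sub_zero], Or.inr ?_⟩
      rw [inv_tau hρρ hττ]; congr 1; abel

/-- **Restriction to an index-two subgroup kills the dicyclic law** (see the module docstring): dicyclic type, `c₀ ≠ 0`,
`|A| ≡ 2 (mod 3)`, `|A| ≥ 28`, `A/⟨c₀⟩ ↠ 𝔽₂³`; a TPP triple attaining `3|S||T||U| + 16 = 8|A|`; `φ : A →+ ZMod 2` non-zero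
with `φ c₀ = 0`, constant `e` on `S₀`, `e + φ x` on `S₁`, `f` on `U₀`, `f + φ x` on `U₁` (so `S` and `U` lie in right
cosets of `H = ρ(ker φ) ∪ τ(x + ker φ)`).  Then `False`. [folklore] -/
theorem no_dicyclic_law_of_two_small
    (hρρ : ∀ a b, ρ a * ρ b = ρ (a + b)) (hρτ : ∀ a b, ρ a * τ b = τ (b - a))
    (hτρ : ∀ a b, τ a * ρ b = τ (a + b)) (hττ : ∀ a b, τ a * τ b = ρ (c₀ + b - a)) (hc₀ : c₀ ≠ 0)
    (hρ : Function.Injective ρ) (hτ : Function.Injective τ) (hne : ∀ a b, ρ a ≠ τ b)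
    (hsurj : ∀ g, (∃ a, ρ a = g) ∨ (∃ a, τ a = g)) (hmod : Fintype.card A % 3 = 2) (hA : 28 ≤ Fintype.card A)
    (ψ₁ ψ₂ ψ₃ : A →+ ZMod 2) (hψc : ψ₁ c₀ = 0 ∧ ψ₂ c₀ = 0 ∧ ψ₃ c₀ = 0)
    (hψ : ∀ v : ZMod 2 × ZMod 2 × ZMod 2, ∃ y, (ψ₁ y, ψ₂ y, ψ₃ y) = v)
    {S T U : Finset G} (h : TripleProductProperty S T U)
    (hV : 3 * (S.card * T.card * U.card) + 16 = 8 * Fintype.card A)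
    (φ : A →+ ZMod 2) (hφc : φ c₀ = 0) (hφ : ∃ a, φ a ≠ 0) (x : A) (e f : ZMod 2)
    (hS₀ : ∀ a, ρ a ∈ S → φ a = e) (hS₁ : ∀ a, τ a ∈ S → φ a = e + φ x)
    (hU₀ : ∀ a, ρ a ∈ U → φ a = f) (hU₁ : ∀ a, τ a ∈ U → φ a = f + φ x) : False := by
  classical
  have zmod2_eq_one_of_ne_zero : ∀ {z : ZMod 2}, z ≠ 0 → z = 1 := by decide
  -- `φ` is onto; an element `a₁` with `φ a₁ = 1`, and preimages of `e`, `f`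
  obtain ⟨a₁, ha₁'⟩ := hφ
  have ha₁ : φ a₁ = 1 := zmod2_eq_one_of_ne_zero ha₁'
  have hφsurj : Function.Surjective φ := by
    intro v
    by_cases hv : v = 0
    · exact ⟨0, by rw [map_zero, hv]⟩
    · exact ⟨a₁, by rw [ha₁, zmod2_eq_one_of_ne_zero hv]⟩
  obtain ⟨aₑ, haₑ⟩ := hφsurj e
  obtain ⟨a_f, ha_f⟩ := hφsurj f
  -- the subgroup `H`
  obtain ⟨H, hH⟩ := exists_subgroup_of_hom hρρ hρτ hτρ hττ φ hφc x
  -- `S·ρ(−aₑ) ⊆ H`, `U·ρ(−a_f) ⊆ H`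
  have hSH : ∀ g ∈ S.map (Equiv.mulRight (ρ (-aₑ))).toEmbedding, g ∈ H := by
    intro g hg
    rw [mem_map_mulRight_iff, inv_rho hρρ, neg_neg] at hg
    have eg : g = g * ρ aₑ * ρ (-aₑ) := by rw [mul_assoc, hρρ, add_neg_cancel, rho_zero hρρ, mul_one]
    rcases hsurj (g * ρ aₑ) with ⟨a, ha⟩ | ⟨a, ha⟩
    · rw [← ha] at hg
      refine (hH g).2 ⟨a + -aₑ, by rw [map_add, map_neg, hS₀ a hg, haₑ, add_neg_cancel], Or.inl ?_⟩
      rw [eg, ← ha, hρρ]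
    · rw [← ha] at hg
      refine (hH g).2 ⟨a + -aₑ - x, ?_, Or.inr ?_⟩
      · rw [map_sub, map_add, map_neg, hS₁ a hg, haₑ]; abel
      · rw [eg, ← ha, hτρ]; congr 1; abel
  have hUH : ∀ g ∈ U.map (Equiv.mulRight (ρ (-a_f))).toEmbedding, g ∈ H := by
    intro g hg
    rw [mem_map_mulRight_iff, inv_rho hρρ, neg_neg] at hg
    have eg : g = g * ρ a_f * ρ (-a_f) := by rw [mul_assoc, hρρ, add_neg_cancel, rho_zero hρρ, mul_one]
    rcases hsurj (g * ρ a_f) with ⟨a, ha⟩ | ⟨a, ha⟩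
    · rw [← ha] at hg
      refine (hH g).2 ⟨a + -a_f, by rw [map_add, map_neg, hU₀ a hg, ha_f, add_neg_cancel], Or.inl ?_⟩
      rw [eg, ← ha, hρρ]
    · rw [← ha] at hg
      refine (hH g).2 ⟨a + -a_f - x, ?_, Or.inr ?_⟩
      · rw [map_sub, map_add, map_neg, hU₁ a hg, ha_f]; abel
      · rw [eg, ← ha, hτρ]; congr 1; abel
  -- an element outside `H` is moved into `H` by `ρ(−a₁)`
  have hmove : ∀ g : G, g ∉ H → g * ρ (-a₁) ∈ H := by
    intro g hg
    rcases hsurj g with ⟨a, rfl⟩ | ⟨a, rfl⟩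
    · have hφa : φ a = 1 := by
        apply zmod2_eq_one_of_ne_zero
        intro h0
        exact hg ((hH _).2 ⟨a, h0, Or.inl rfl⟩)
      refine (hH _).2 ⟨a + -a₁, by rw [map_add, map_neg, hφa, ha₁, add_neg_cancel], Or.inl ?_⟩
      rw [hρρ]
    · have hφa : φ (a - x) = 1 := by
        apply zmod2_eq_one_of_ne_zero
        intro h0
        exact hg ((hH _).2 ⟨a - x, h0, Or.inr (by congr 1; abel)⟩)
      refine (hH _).2 ⟨a - x + -a₁, by rw [map_add, map_neg, hφa, ha₁, add_neg_cancel], Or.inr ?_⟩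
      rw [hτρ]; congr 1; abel
  -- the larger half of `T`, translated into `H`
  obtain ⟨T₀, r, hT₀T, hT₀card, hT₀H⟩ :
      ∃ (T₀ : Finset G) (r : G), T₀ ⊆ T ∧ T.card ≤ 2 * T₀.card ∧ ∀ g ∈ T₀, g * r ∈ H := by
    have hsplit := Finset.card_filter_add_card_filter_not (s := T) (fun g => g ∈ H)
    by_cases hbig : T.card ≤ 2 * (T.filter fun g => g ∈ H).card
    · refine ⟨T.filter fun g => g ∈ H, 1, filter_subset _ _, hbig, fun g hg => ?_⟩
      rw [mul_one]; exact (mem_filter.1 hg).2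
    · refine ⟨T.filter fun g => ¬ g ∈ H, ρ (-a₁), filter_subset _ _, by omega, fun g hg => ?_⟩
      exact hmove g (mem_filter.1 hg).2
  -- the translated triple inside `H`
  set S' := S.map (Equiv.mulRight (ρ (-aₑ))).toEmbedding with hS'
  set T' := T₀.map (Equiv.mulRight r).toEmbedding with hT'
  set U' := U.map (Equiv.mulRight (ρ (-a_f))).toEmbedding with hU'
  have hT'H : ∀ g ∈ T', g ∈ H := by
    intro g hg
    rw [hT', mem_map_mulRight_iff] at hg
    have := hT₀H _ hg
    rwa [inv_mul_cancel_right] at this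
  have htpp' : TripleProductProperty S' T' U' := (h.mono (Subset.refl _) hT₀T (Subset.refl _)).map_mulRight _ _ _
  -- inside the group `H`
  set S'' : Finset H := S'.subtype (· ∈ H) with hS''
  set T'' : Finset H := T'.subtype (· ∈ H) with hT''
  set U'' : Finset H := U'.subtype (· ∈ H) with hU''
  have htpp'' : TripleProductProperty S'' T'' U'' := tpp_subtype H htpp'
  have cS'' : S''.card = S.card := by rw [hS'', card_subtype_of_subset H hSH, hS', card_map]
  have cT'' : T''.card = T₀.card := by rw [hT'', card_subtype_of_subset H hT'H, hT', card_map]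
  have cU'' : U''.card = U.card := by rw [hU'', card_subtype_of_subset H hUH, hU', card_map]
  -- the presentation of `H` over `A' = ker φ`
  set A' : AddSubgroup A := φ.ker with hA'
  have hc₀' : c₀ ∈ A' := by rw [hA', AddMonoidHom.mem_ker]; exact hφc
  set c₀' : A' := ⟨c₀, hc₀'⟩ with hc₀'def
  have memA' : ∀ a : A', φ (a : A) = 0 := fun a => (AddMonoidHom.mem_ker).1 a.2
  set ρ' : A' → H := fun a => ⟨ρ a, (hH _).2 ⟨a, memA' a, Or.inl rfl⟩⟩ with hρ'def
  set τ' : A' → H := fun a => ⟨τ (x + a), (hH _).2 ⟨a, memA' a, Or.inr rfl⟩⟩ with hτ'def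
  have hρρ' : ∀ a b, ρ' a * ρ' b = ρ' (a + b) := fun a b => by
    apply Subtype.ext
    show ρ (a : A) * ρ (b : A) = ρ ((a + b : A') : A)
    rw [hρρ, AddSubgroup.coe_add]
  have hρτ' : ∀ a b, ρ' a * τ' b = τ' (b - a) := fun a b => by
    apply Subtype.ext
    show ρ (a : A) * τ (x + (b : A)) = τ (x + ((b - a : A') : A))
    rw [hρτ, AddSubgroup.coe_sub]; congr 1; abel
  have hτρ' : ∀ a b, τ' a * ρ' b = τ' (a + b) := fun a b => by
    apply Subtype.ext
    show τ (x + (a : A)) * ρ (b : A) = τ (x + ((a + b : A') : A))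
    rw [hτρ, AddSubgroup.coe_add]; congr 1; abel
  have hττ' : ∀ a b, τ' a * τ' b = ρ' (c₀' + b - a) := fun a b => by
    apply Subtype.ext
    show τ (x + (a : A)) * τ (x + (b : A)) = ρ (((c₀' + b - a : A') : A))
    rw [hττ, AddSubgroup.coe_sub, AddSubgroup.coe_add]; congr 1
    show c₀ + (x + (b : A)) - (x + (a : A)) = c₀ + (b : A) - (a : A)
    abel
  have hρ'inj : Function.Injective ρ' := fun a b hab => by
    apply Subtype.ext
    exact hρ (congrArg Subtype.val hab)
  have hτ'inj : Function.Injective τ' := fun a b hab => by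
    apply Subtype.ext
    have := hτ (congrArg Subtype.val hab)
    exact add_left_cancel this
  have hne' : ∀ a b, ρ' a ≠ τ' b := fun a b hab => hne _ _ (congrArg Subtype.val hab)
  have hsurj' : ∀ g : H, (∃ a, ρ' a = g) ∨ (∃ a, τ' a = g) := by
    intro g
    obtain ⟨a, ha, hg⟩ := (hH g).1 g.2
    have haA' : a ∈ A' := by rw [hA', AddMonoidHom.mem_ker]; exact ha
    rcases hg with hg | hg
    · exact Or.inl ⟨⟨a, haA'⟩, Subtype.ext hg.symm⟩
    · exact Or.inr ⟨⟨a, haA'⟩, Subtype.ext hg.symm⟩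
  have hc₀'ne : c₀' ≠ 0 := fun h0 => hc₀ (congrArg Subtype.val h0)
  -- `|A'| = |A|/2`
  have hcardA' : 2 * Fintype.card A' = Fintype.card A := by
    have h1 := DihedralLikeGroup.card_ker_mul_card φ hφsurj
    rw [ZMod.card] at h1
    have h2 : Fintype.card A' = (univ.filter fun a : A => φ a = 0).card := by
      have : Fintype.card A' = (univ.filter fun a : A => a ∈ A').card := by convert Fintype.card_subtype _
      rw [this]
      congr 1
      apply filter_congr
      intro a _
      rw [hA', AddMonoidHom.mem_ker]
    rw [h2]; omega
  have hmod' : Fintype.card A' % 3 = 1 := by omega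
  have hA14 : 14 ≤ Fintype.card A' := by omega
  have h7 : 7 ≤ Fintype.card A' := by omega
  -- the mod-one law bound in `H`, and attainment
  have hle := tpp_volume_le_law_dihedralLike_mod_one hρρ' hρτ' hτρ' hττ' hρ'inj hτ'inj hne' hsurj' hmod' h7 htpp''
  rw [cS'', cT'', cU''] at hle
  obtain ⟨k, hk⟩ : ∃ k, Fintype.card A' = 3 * k + 1 := ⟨Fintype.card A' / 3, by omega⟩
  have hdiv : 2 * Fintype.card A' / 3 = 2 * k := by rw [hk]; omega
  rw [hdiv] at hle
  have hV' : 3 * (S''.card * T''.card * U''.card) + 8 = 8 * Fintype.card A' := by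
    rw [cS'', cT'', cU'']
    have h1 : S.card * T.card * U.card ≤ 2 * (S.card * T₀.card * U.card) := by
      have := Nat.mul_le_mul_left (S.card * U.card) hT₀card
      nlinarith [this]
    omega
  -- gen 8: `A'/⟨c₀⟩` is cyclic
  obtain ⟨g, hg⟩ := quot_cyclic_of_mod_one_law_of_c0_ne_zero hρρ' hρτ' hτρ' hττ' hc₀'ne hρ'inj hτ'inj hne' hsurj'
    hmod' hA14 htpp'' hV'
  -- transfer to `A`: four cosets of `⟨g⟩`
  have hlift : ∀ y : A', y ∈ AddSubgroup.zmultiples g → (y : A) ∈ AddSubgroup.zmultiples (g : A) := by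
    intro y hy
    obtain ⟨m, hm⟩ := AddSubgroup.mem_zmultiples_iff.1 hy
    exact AddSubgroup.mem_zmultiples_iff.2 ⟨m, by rw [← AddSubgroupClass.coe_zsmul, hm]⟩
  have hcov : ∀ y : A, y ∈ AddSubgroup.zmultiples (g : A) ∨ y - a₁ ∈ AddSubgroup.zmultiples (g : A) ∨
      y + c₀ ∈ AddSubgroup.zmultiples (g : A) ∨ y + c₀ - a₁ ∈ AddSubgroup.zmultiples (g : A) := by
    intro y
    by_cases hy : φ y = 0
    · have hyA' : y ∈ A' := by rw [hA', AddMonoidHom.mem_ker]; exact hy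
      rcases hg ⟨y, hyA'⟩ with h0 | h0
      · exact Or.inl (hlift _ h0)
      · exact Or.inr (Or.inr (Or.inl (hlift _ h0)))
    · have hy1 : φ y = 1 := zmod2_eq_one_of_ne_zero hy
      have hyA' : y - a₁ ∈ A' := by rw [hA', AddMonoidHom.mem_ker, map_sub, hy1, ha₁, sub_self]
      rcases hg ⟨y - a₁, hyA'⟩ with h0 | h0
      · exact Or.inr (Or.inl (hlift _ h0))
      · refine Or.inr (Or.inr (Or.inr ?_))
        have := hlift _ h0
        have e1 : (((⟨y - a₁, hyA'⟩ : A') + c₀' : A') : A) = y + c₀ - a₁ := by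
          show y - a₁ + c₀ = y + c₀ - a₁
          abel
        rwa [e1] at this
  exact psi_not_onto_of_four_cosets ψ₁ ψ₂ ψ₃ hψc hcov hψ

/-- The restriction theorem for the pair `(S, T)`. [folklore] -/
theorem no_dicyclic_law_of_two_small_first_second
    (hρρ : ∀ a b, ρ a * ρ b = ρ (a + b)) (hρτ : ∀ a b, ρ a * τ b = τ (b - a))
    (hτρ : ∀ a b, τ a * ρ b = τ (a + b)) (hττ : ∀ a b, τ a * τ b = ρ (c₀ + b - a)) (hc₀ : c₀ ≠ 0)
    (hρ : Function.Injective ρ) (hτ : Function.Injective τ) (hne : ∀ a b, ρ a ≠ τ b)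
    (hsurj : ∀ g, (∃ a, ρ a = g) ∨ (∃ a, τ a = g)) (hmod : Fintype.card A % 3 = 2) (hA : 28 ≤ Fintype.card A)
    (ψ₁ ψ₂ ψ₃ : A →+ ZMod 2) (hψc : ψ₁ c₀ = 0 ∧ ψ₂ c₀ = 0 ∧ ψ₃ c₀ = 0)
    (hψ : ∀ v : ZMod 2 × ZMod 2 × ZMod 2, ∃ y, (ψ₁ y, ψ₂ y, ψ₃ y) = v)
    {S T U : Finset G} (h : TripleProductProperty S T U)
    (hV : 3 * (S.card * T.card * U.card) + 16 = 8 * Fintype.card A)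
    (φ : A →+ ZMod 2) (hφc : φ c₀ = 0) (hφ : ∃ a, φ a ≠ 0) (x : A) (e f : ZMod 2)
    (hS₀ : ∀ a, ρ a ∈ S → φ a = e) (hS₁ : ∀ a, τ a ∈ S → φ a = e + φ x)
    (hT₀ : ∀ a, ρ a ∈ T → φ a = f) (hT₁ : ∀ a, τ a ∈ T → φ a = f + φ x) : False :=
  -- rotate to `(T, U, S)`: `T` first, `S` third
  no_dicyclic_law_of_two_small hρρ hρτ hτρ hττ hc₀ hρ hτ hne hsurj hmod hA ψ₁ ψ₂ ψ₃ hψc hψ h.rotate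
    (by rw [show T.card * U.card * S.card = S.card * T.card * U.card by ring]; exact hV) φ hφc hφ x f e hT₀ hT₁ hS₀ hS₁

/-- The restriction theorem for the pair `(T, U)`. [folklore] -/
theorem no_dicyclic_law_of_two_small_second_third
    (hρρ : ∀ a b, ρ a * ρ b = ρ (a + b)) (hρτ : ∀ a b, ρ a * τ b = τ (b - a))
    (hτρ : ∀ a b, τ a * ρ b = τ (a + b)) (hττ : ∀ a b, τ a * τ b = ρ (c₀ + b - a)) (hc₀ : c₀ ≠ 0)
    (hρ : Function.Injective ρ) (hτ : Function.Injective τ) (hne : ∀ a b, ρ a ≠ τ b)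
    (hsurj : ∀ g, (∃ a, ρ a = g) ∨ (∃ a, τ a = g)) (hmod : Fintype.card A % 3 = 2) (hA : 28 ≤ Fintype.card A)
    (ψ₁ ψ₂ ψ₃ : A →+ ZMod 2) (hψc : ψ₁ c₀ = 0 ∧ ψ₂ c₀ = 0 ∧ ψ₃ c₀ = 0)
    (hψ : ∀ v : ZMod 2 × ZMod 2 × ZMod 2, ∃ y, (ψ₁ y, ψ₂ y, ψ₃ y) = v)
    {S T U : Finset G} (h : TripleProductProperty S T U)
    (hV : 3 * (S.card * T.card * U.card) + 16 = 8 * Fintype.card A)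
    (φ : A →+ ZMod 2) (hφc : φ c₀ = 0) (hφ : ∃ a, φ a ≠ 0) (x : A) (e f : ZMod 2)
    (hT₀ : ∀ a, ρ a ∈ T → φ a = e) (hT₁ : ∀ a, τ a ∈ T → φ a = e + φ x)
    (hU₀ : ∀ a, ρ a ∈ U → φ a = f) (hU₁ : ∀ a, τ a ∈ U → φ a = f + φ x) : False :=
  -- rotate to `(U, S, T)`: `U` first, `T` third
  no_dicyclic_law_of_two_small hρρ hρτ hτρ hττ hc₀ hρ hτ hne hsurj hmod hA ψ₁ ψ₂ ψ₃ hψc hψ h.rotate.rotate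
    (by rw [show U.card * S.card * T.card = S.card * T.card * U.card by ring]; exact hV) φ hφc hφ x f e hU₀ hU₁ hT₀ hT₁

/-- **Class P1 re-derived for ALL quotients of `2`-rank `≥ 3`** (third proof; cf. `no_two_domino_dicyclic_law_of_rank_three`,
`no_dicyclic_law_of_two_domino'`): two dominoes `S = {ρ s₀, τ s₁}`, `T = {ρ t₀, τ t₁}` lie in cosets of the common
subgroup `H` given by any `φ ≠ 0` killing `c₀` and `(t₁ − t₀) − (s₁ − s₀)`; such `φ` exists inside the span of
`ψ₁, ψ₂, ψ₃`. [folklore] -/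
theorem no_dicyclic_law_of_two_domino_restrict
    (hρρ : ∀ a b, ρ a * ρ b = ρ (a + b)) (hρτ : ∀ a b, ρ a * τ b = τ (b - a))
    (hτρ : ∀ a b, τ a * ρ b = τ (a + b)) (hττ : ∀ a b, τ a * τ b = ρ (c₀ + b - a)) (hc₀ : c₀ ≠ 0)
    (hρ : Function.Injective ρ) (hτ : Function.Injective τ) (hne : ∀ a b, ρ a ≠ τ b)
    (hsurj : ∀ g, (∃ a, ρ a = g) ∨ (∃ a, τ a = g)) (hmod : Fintype.card A % 3 = 2) (hA : 28 ≤ Fintype.card A)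
    (ψ₁ ψ₂ ψ₃ : A →+ ZMod 2) (hψc : ψ₁ c₀ = 0 ∧ ψ₂ c₀ = 0 ∧ ψ₃ c₀ = 0)
    (hψ : ∀ v : ZMod 2 × ZMod 2 × ZMod 2, ∃ y, (ψ₁ y, ψ₂ y, ψ₃ y) = v)
    {S T U : Finset G} (h : TripleProductProperty S T U)
    {s₀ s₁ t₀ t₁ : A} (hS : S = {ρ s₀, τ s₁}) (hT : T = {ρ t₀, τ t₁}) :
    3 * (S.card * T.card * U.card) + 16 ≠ 8 * Fintype.card A := by
  intro hV
  have zmod2_eq_one_of_ne_zero : ∀ {z : ZMod 2}, z ≠ 0 → z = 1 := by decide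
  have zmod2_one_add_one : (1 : ZMod 2) + 1 = 0 := by decide
  -- a non-zero `φ` in the span of `ψ₁, ψ₂` killing `d = (t₁ − t₀) − (s₁ − s₀)`
  set d : A := t₁ - t₀ - (s₁ - s₀) with hd
  obtain ⟨φ, hφc, hφ, hφd⟩ : ∃ φ : A →+ ZMod 2, φ c₀ = 0 ∧ (∃ a, φ a ≠ 0) ∧ φ d = 0 := by
    -- independent witnesses for `ψ₁`, `ψ₂`
    obtain ⟨y₁, hy₁⟩ := hψ (1, 0, 0)
    obtain ⟨y₂, hy₂⟩ := hψ (0, 1, 0)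
    simp only [Prod.mk.injEq] at hy₁ hy₂
    by_cases h1 : ψ₁ d = 0
    · exact ⟨ψ₁, hψc.1, ⟨y₁, by rw [hy₁.1]; exact one_ne_zero⟩, h1⟩
    by_cases h2 : ψ₂ d = 0
    · exact ⟨ψ₂, hψc.2.1, ⟨y₂, by rw [hy₂.2.1]; exact one_ne_zero⟩, h2⟩
    refine ⟨ψ₁ + ψ₂, by rw [AddMonoidHom.add_apply, hψc.1, hψc.2.1, add_zero], ⟨y₁, ?_⟩, ?_⟩
    · rw [AddMonoidHom.add_apply, hy₁.1, hy₁.2.1, add_zero]; exact one_ne_zero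
    · rw [AddMonoidHom.add_apply, zmod2_eq_one_of_ne_zero h1, zmod2_eq_one_of_ne_zero h2, zmod2_one_add_one]
  refine no_dicyclic_law_of_two_small_first_second hρρ hρτ hτρ hττ hc₀ hρ hτ hne hsurj hmod hA ψ₁ ψ₂ ψ₃ hψc hψ h hV
    φ hφc hφ (s₁ - s₀) (φ s₀) (φ t₀) ?_ ?_ ?_ ?_
  · intro a ha
    rw [hS, mem_insert, mem_singleton] at ha
    rcases ha with ha | ha
    · rw [hρ ha]
    · exact absurd ha (hne a s₁)
  · intro a ha
    rw [hS, mem_insert, mem_singleton] at ha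
    rcases ha with ha | ha
    · exact absurd ha.symm (hne s₀ a)
    · rw [hτ ha, map_sub]; abel
  · intro a ha
    rw [hT, mem_insert, mem_singleton] at ha
    rcases ha with ha | ha
    · rw [hρ ha]
    · exact absurd ha (hne a t₁)
  · intro a ha
    rw [hT, mem_insert, mem_singleton] at ha
    rcases ha with ha | ha
    · exact absurd ha.symm (hne t₀ a)
    · rw [hτ ha]
      have : φ t₁ = φ t₀ + φ (s₁ - s₀) + φ d := by simp only [hd, map_sub]; abel
      rw [this, hφd, add_zero]

end Restriction

end Summit.MatrixMultiplication.OmegaCensus
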